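import Summits.Ventures.HodgeRepro2.T6ShadowHost2
import Summits.Ventures.HodgeRepro2.T6A1HypHost
import Summits.Ventures.HodgeRepro2.T6A2WeilShadow
import Summits.Ventures.HodgeRepro2.T6A2WeilGroupLaw
import Summits.Ventures.HodgeRepro2.T6A2WeilGen
import Summits.Ventures.HodgeRepro2.T6A2WeilOrder
import Summits.Ventures.HodgeRepro2.T6A2WeilLef2
import Summits.Ventures.HodgeRepro2.T6A2HypLef
import Summits.Ventures.HodgeRepro2.T6A2HypHost
import Summits.Ventures.HodgeRepro2.T6A2WeilTensor

/-!
# T6A2WeilAssembly — the transfer shadow of the corner product and its `halg`, with every binder sourced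

Cell pub-hodge-repro2, Tier 6 (README §10), seat t6-p2 (A2 host side; the lead's ask STATUS l. 11151 (3)(b)).
The binders `D : TransferShadow C.F` and `halg` of the lead's `splitWeilAlgebraic_of_displays` (T6ShadowHost2),
built from host data and the displays alone:
* `situationOf C S f hBB hSB : SituationData ℂ` — the A2 situation of the corner product `B := cornerSPVar C`
  with its group law `μ[C.B.X]` and the surface `f : S → B` of the N side;
* `productsSmooth_of_tensor` — the 16 product-smoothness instances from the host's named Prop
  `IsSmoothProjective.tensor`;
* **`shadowOf`** — `transferShadowWeil` with `W := Bd.W`, `hgen := hasGens` (a theorem), `hten` from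
  the display `Hyp.Hartshorne1977_productProjective`, `A := orderActionW` (the host's order and t6-p1's `phiW`, with the lead's
  `hT_of_clauses` / `isCompl_hodgeHC_one`), `hL := hL_corner Bd C hD` (the Lange display), `hdim := C.dim_eq`,
  `hdimS := hS`, `G := GroupLaw.ofMonObj`, `hpt` from the display `Hyp.Hartshorne1977_pointProjective`, and `hLef` from t6-p1's
  `alg_lefschetz_HC` (the Lefschetz (1,1) display through `hLef_of_lefschetz11` + clause (b), Thm. 1.1.21 (b)
  through `span11_le_of_eq`, Lange in degree 2 `lange2C`) by `hLef_of_lange2_mem`;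
* **`halgOf`** — the lead's `halg` binder for `shadowOf`, by `lange4_extC_mem_baseChange_coniveau`
  (`hφ := phi_h1ToC_eq_tmul`, `hb := hB.2.1 C.smooth`; the types agree by `rfl`);
* **`splitWeilAlgebraic_of_A2`** — the lead's composite applied to them: `Hyp.PeriodN (shadowOf …) →
  SplitWeilAlgebraic C`.
Hypotheses consumed BY NAME: `Hyp.BettiHodge`'s clauses (`hB`), `Hyp.LangeBirkenhake1992_Prop1_1_20 Bd` (`hD`),
`Hyp.Lefschetz11_Betti Bd` (`hLefD`), `Hyp.LangeBirkenhake1992_Thm1_1_21_Betti Bd` (`hT21`), `Lemma1117Q`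
(`h17`), and the two host-Prop displays `Hyp.Hartshorne1977_productProjective` (`hProd`) /
`Hyp.Hartshorne1977_pointProjective` (`hPt`) (T6A2HypHost);
the surface `S`, `f`, `hS` are the N side's data. No `sorry`; standard axioms.
§8(d): uses an L-value-free non-vanishing device: NO.
-/

noncomputable section

namespace Summit.Ventures.HodgeRepro2.T6.WeilAssembly

open CategoryTheory MonoidalCategory
open scoped TensorProduct MonObj
open HostAPI.Carriers.AlgebraicGeometry.Motives HostAPI.Carriers.AlgebraicGeometry.HodgeTheory
open Summit.Ventures.HodgeRepro2.T6 Host WeilInst WeilLange WeilOrder WeilHalg A1Dict A1HostBetti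
  A1HostOrder A1BaseChange

section situation

variable {K : Type} [Field K] [NumberField K] [NumberField.IsCMField K] (C : CornerProduct K)

/-- THE A2 SITUATION OF THE CORNER PRODUCT: `B := cornerSPVar C` with the group law `μ[C.B.X]` of the host's
abelian variety, and the surface `f : S → B` (an `abbrev`, so that `(situationOf …).B.X` IS `C.B.X`). -/
abbrev situationOf (S : SPVar ℂ) (f : S.X ⟶ C.B.X)
    (hBB : IsSmoothProjective (C.B.dim + C.B.dim) (C.B.X ⊗ C.B.X))
    (hSB : IsSmoothProjective (S.n + C.B.dim) (S.X ⊗ C.B.X)) : SituationData ℂ :=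
  ⟨cornerSPVar C, μ[C.B.X], S, f, hBB, hSB⟩

/-- the 16 product-smoothness instances of a situation from the host's named Prop `IsSmoothProjective.tensor` -/
theorem productsSmooth_of_tensor (D : SituationData ℂ)
    (ht : ∀ (n m : ℕ) (X Y : SchemeOver ℂ), IsSmoothProjective.tensor (n := n) (m := m) (X := X) (Y := Y)) :
    D.ProductsSmooth :=
  fun i j => ht _ _ _ _ (D.spaces i).smooth (D.spaces j).smooth

end situation

section shadow

variable {K : Type} [Field K] [NumberField K] [NumberField.IsCMField K]
  (coeffC : ∀ (X : SchemeOver ℂ) (k : ℕ), HC X k →ₗ[ℂ] H X k) (Bd : BettiHodgeData ℂ)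

/-- the `OrderAction` of the corner product from the clauses (the lead's `hT_of_clauses` /
`isCompl_hodgeHC_one`) and Lemma 1.1.17 -/
def orderActionOf (hnat : CoeffNatural coeffC) (hB : BettiClauses coeffC Bd) (C : CornerProduct K)
    (h17 : Lemma1117Q) : OrderAction Bd.W (cornerSPVar C) K :=
  orderActionW Bd C (hT_of_clauses coeffC Bd hnat hB.1 hB.2.2 C)
    (fun i => isCompl_hodgeHC_one Bd hB.2.2 (C.A i).smooth) (isCompl_hodgeHC_one Bd hB.2.2 C.smooth) h17

/-- the A2 situation of the corner product from the product display -/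
abbrev situationOf' (C : CornerProduct K) (S : SPVar ℂ) (f : S.X ⟶ C.B.X)
    (hProd : Hyp.Hartshorne1977_productProjective) : SituationData ℂ :=
  situationOf C S f (tensor_of_display hProd _ _ _ _ C.smooth C.smooth) (tensor_of_display hProd _ _ _ _ S.smooth C.smooth)

/-- THE LEFSCHETZ (1,1) BINDER for the corner product's shadow, from the displays by name. -/
theorem hLefOf (hnat : CoeffNatural coeffC) (hB : BettiClauses coeffC Bd) (C : CornerProduct K)
    (h17 : Lemma1117Q) (hD : Hyp.LangeBirkenhake1992_Prop1_1_20 Bd) (hLefD : Hyp.Lefschetz11_Betti Bd)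
    (hT21 : Hyp.LangeBirkenhake1992_Thm1_1_21_Betti Bd) (S : SPVar ℂ) (f : S.X ⟶ C.B.X)
    (hProd : Hyp.Hartshorne1977_productProjective) :
    ∀ a ∈ degB K 2, extC K a ∈ hodge C.F 1 1 →
      a ∈ (identB Bd.W (situationOf' C S f hProd) (SituationData.hasGens _)
        (productsSmooth_of_tensor _ (tensor_of_display hProd)) (orderActionOf coeffC Bd hnat hB C h17)
        (hL_corner Bd C hD)).algOf 1 :=
  hLef_of_lange2_mem Bd (situationOf' C S f hProd) (orderActionOf coeffC Bd hnat hB C h17) (hL_corner Bd C hD)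
    (SituationData.hasGens _) (productsSmooth_of_tensor _ (tensor_of_display hProd)) C.F
    ((factorIdentHC Bd C (hT_of_clauses coeffC Bd hnat hB.1 hB.2.2 C)
      (fun i => isCompl_hodgeHC_one Bd hB.2.2 (C.A i).smooth) (isCompl_hodgeHC_one Bd hB.2.2 C.smooth) h17).phi
      C.F.deg6)
    (phi_h1ToC_eq_tmul Bd C (hT_of_clauses coeffC Bd hnat hB.1 hB.2.2 C)
      (fun i => isCompl_hodgeHC_one Bd hB.2.2 (C.A i).smooth) (isCompl_hodgeHC_one Bd hB.2.2 C.smooth) h17)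
    (hB.2.1 C.smooth)
    (alg_lefschetz_HC Bd C (hT_of_clauses coeffC Bd hnat hB.1 hB.2.2 C)
      (fun i => isCompl_hodgeHC_one Bd hB.2.2 (C.A i).smooth) (isCompl_hodgeHC_one Bd hB.2.2 C.smooth) h17
      (hLef_of_lefschetz11 Bd C hLefD hB.2.1) (span11_le_of_eq Bd C (hT21 C.B C.smooth))
      (lange2C Bd (cornerSPVar C) (hL_corner Bd C hD)) (lange2C_corner_ιMulti Bd C (hL_corner Bd C hD)))

/-- **THE TRANSFER SHADOW OF THE CORNER PRODUCT FROM THE DISPLAYS** — the `D` of the lead's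
`splitWeilAlgebraic_of_displays`: `transferShadowWeil` with every binder sourced. -/
def shadowOf (hnat : CoeffNatural coeffC) (hB : BettiClauses coeffC Bd) (C : CornerProduct K)
    (h17 : Lemma1117Q) (hD : Hyp.LangeBirkenhake1992_Prop1_1_20 Bd) (hLefD : Hyp.Lefschetz11_Betti Bd)
    (hT21 : Hyp.LangeBirkenhake1992_Thm1_1_21_Betti Bd) (S : SPVar ℂ) (hS : S.n = 2) (f : S.X ⟶ C.B.X)
    (hProd : Hyp.Hartshorne1977_productProjective) (hPt : Hyp.Hartshorne1977_pointProjective) :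
    TransferShadow C.F :=
  transferShadowWeil Bd.W (situationOf' C S f hProd) (SituationData.hasGens _) (productsSmooth_of_tensor _ (tensor_of_display hProd))
    (orderActionOf coeffC Bd hnat hB C h17) (hL_corner Bd C hD) C.F C.dim_eq hS
    (@GroupLaw.ofMonObj ℂ _ (situationOf' C S f hProd) (inferInstanceAs (MonObj C.B.X)) rfl) (unit_of_display hPt)
    (hLefOf coeffC Bd hnat hB C h17 hD hLefD hT21 S f hProd)

/-- **THE `halg` BINDER OF THE LEAD'S COMPOSITE FOR `shadowOf`**: the algebraic degree-2 classes of the shadow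
go to the base change of the host's `coniveau B 4 2` under the A1 identification's `φ₄`. -/
theorem halgOf (hnat : CoeffNatural coeffC) (hB : BettiClauses coeffC Bd) (C : CornerProduct K)
    (h17 : Lemma1117Q) (hD : Hyp.LangeBirkenhake1992_Prop1_1_20 Bd) (hLefD : Hyp.Lefschetz11_Betti Bd)
    (hT21 : Hyp.LangeBirkenhake1992_Thm1_1_21_Betti Bd) (S : SPVar ℂ) (hS : S.n = 2) (f : S.X ⟶ C.B.X)
    (hProd : Hyp.Hartshorne1977_productProjective) (hPt : Hyp.Hartshorne1977_pointProjective) :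
    ∀ y ∈ (shadowOf coeffC Bd hnat hB C h17 hD hLefD hT21 S hS f hProd hPt).Alg 2,
      (hostIdentW_of_displays coeffC Bd hnat hB C h17 hD).φ₄ (extC K y) ∈
        (coniveau C.B.X (2 * 2) 2).baseChange ℂ :=
  fun y hy =>
    lange4_extC_mem_baseChange_coniveau Bd (situationOf' C S f hProd) (orderActionOf coeffC Bd hnat hB C h17)
      (hL_corner Bd C hD) (SituationData.hasGens _) (productsSmooth_of_tensor _ (tensor_of_display hProd))
      ((factorIdentHC Bd C (hT_of_clauses coeffC Bd hnat hB.1 hB.2.2 C)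
        (fun i => isCompl_hodgeHC_one Bd hB.2.2 (C.A i).smooth) (isCompl_hodgeHC_one Bd hB.2.2 C.smooth) h17).phi
        C.F.deg6)
      (phi_h1ToC_eq_tmul Bd C (hT_of_clauses coeffC Bd hnat hB.1 hB.2.2 C)
        (fun i => isCompl_hodgeHC_one Bd hB.2.2 (C.A i).smooth) (isCompl_hodgeHC_one Bd hB.2.2 C.smooth) h17)
      (hB.2.1 C.smooth) y hy

/-- **THEOREM A ON THE HOST FOR THE CORNER PRODUCT, FROM THE DISPLAYS**: `Hyp.PeriodN (shadowOf …) →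
SplitWeilAlgebraic C` — the lead's `splitWeilAlgebraic_of_displays` at `shadowOf` / `halgOf`. -/
theorem splitWeilAlgebraic_of_A2 [IsGalois ℚ K] (hnat : CoeffNatural coeffC) (hB : BettiClauses coeffC Bd)
    (C : CornerProduct K) (h17 : Lemma1117Q) (hD : Hyp.LangeBirkenhake1992_Prop1_1_20 Bd)
    (hLefD : Hyp.Lefschetz11_Betti Bd) (hT21 : Hyp.LangeBirkenhake1992_Thm1_1_21_Betti Bd)
    (S : SPVar ℂ) (hS : S.n = 2) (f : S.X ⟶ C.B.X)
    (hProd : Hyp.Hartshorne1977_productProjective) (hPt : Hyp.Hartshorne1977_pointProjective)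
    (hN : Hyp.PeriodN (shadowOf coeffC Bd hnat hB C h17 hD hLefD hT21 S hS f hProd hPt)) :
    SplitWeilAlgebraic C :=
  splitWeilAlgebraic_of_displays coeffC Bd hnat hB C h17 hD _
    (halgOf coeffC Bd hnat hB C h17 hD hLefD hT21 S hS f hProd hPt) hN

end shadow

end Summit.Ventures.HodgeRepro2.T6.WeilAssembly

end
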